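import Summits.ABC.IUTFork.Cor312StepNodesRecloseC
import Summits.ABC.IUTFork.DAGC312t
import HarnessLib

/-!
# [IUTchIII] Cor. 3.12, proof steps (x) and (xi-a) — ZERO-BINDER INSTANCE FORMS of the kernel DAG step nodes
# `N_IUTchIII_Cor3_12_pf_x` / `N_IUTchIII_Cor3_12_pf_xi_a` (FACT-LIST rows F-2163, F-2164), and the whole
# twenty-node chain `N_IUTchIII_Cor3_12_pf` DECIDED at the cell's two census witnesses

S. Mochizuki, *Inter-universal Teichmüller theory III*, proof of Cor. 3.12, kurims `.tex` p. 180 l. 43 – p. 181 l. 44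
[Mochizuki2012; claim key, status disputed]. PROOF-ONLY companion (no definition, no instance, no named fact; abc-iut cell,
seat abc-iut-f-109 gen 10, row LAGA «LABEL-LAG join batch A») of the index nodes of `DAGC312b.lean` and of parts p
(`chain_of_record`, `N_IUTchIII_Cor3_12_pf_x_holds_of`, `N_IUTchIII_Cor3_12_pf_xi_a_holds_of`,
`N_IUTchIII_Cor3_12_pf_xi_d_holds_of`), r (`N_IUTchIII_Cor3_12_pf_xi_f_holds_of_statement`) and t
(`xi_f_hyps_satisfiable` / `xi_f_not_automatic`). The LABEL-LAG join of batch A (HOME/abc-iut-f-109/LABEL-LAG-JOIN-A.tsv)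
found that of its thirteen schema rows exactly two — step (x) F-2163 and step (xi-a) F-2164 — had ONLY CONDITIONAL
instance forms in the tree (three, resp. one, SIDE binder at the readings of record `(lociReadingI, obsReadingA)`;
one DATA binder at the identified-copies reading). This file supplies the zero-binder instance forms:

* §1 `N_IUTchIII_Cor3_12_pf_xi_a_holds_sigStrips` — step (xi-a) at the readings of record holds for EVERY full
  situation, EVERY verbatim setting and EVERY loci parameter once the strips datum is the setting's own
  tautological one `⟨FLGP, FLGP, Flgp⟩` (L6-t4's `GlobalLGPFrobenioidSignature` isomorphism `isoLGPlgp`; the witness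
  inside TEAM A's `Cor312Proof.hNE_satisfiable`) — zero Prop binders, no model;
* §2 at TEAM R's non-vacuity witness (`Cor312.IdentifiedNonVacuity.nvFull` / `nvSetting`, abc-iut-c312-14 lineage:
  typed Thm 3.11 TRUE, typed Statement TRUE): `nvData_logvolInvariant` (the witness' three-level log-volume is
  invariant under the (Ind1)/(Ind2) families, which act by signs and fix the ball), whence steps (x), (xi-a), (xi-d)
  and **the whole twenty-node chain `N_IUTchIII_Cor3_12_pf`** hold there for every `pending` and every strips datum —
  zero binders (`N_IUTchIII_Cor3_12_pf_holds_nvWitness`);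
* §3 at TEAM A's gap witness (`Cor312Vol.GapWitness.gapFull` / `gapSetting`, abc-iut-c312-9 lineage: typed Thm 3.11
  TRUE, typed Statement FALSE): steps (x), (xi-a), (xi-d) hold (the coarse-volume side data are the landed
  `gapData_logvolInvariant` / `gapData_logvol_mono`), every node other than (xi-f) holds
  (`stepNode_holds_gapWitness_of_ne_xi_f`), and **the whole chain FAILS** (`not_N_IUTchIII_Cor3_12_pf_gapWitness`);
* §4 `N_IUTchIII_Cor3_12_pf_undecided_by_typed_thm311`: over full situations in which Theorem 3.11 AS TYPED holds,
  the twenty-node chain of the printed proof under the readings of record is TRUE somewhere and FALSE somewhere —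
  the chain-level form of part t's `xi_f_node_undecided_by_typed_thm311` (the nineteen other inferences hold at
  both witnesses, so the chain is decided by the one node (xi-f), i.e. by the Statement).

HONEST FRAMING. A step node is an INFERENCE of a disputed text under explicit readings; an instance form at a toy
witness says the inference is consistent bookkeeping THERE, nothing about any elliptic curve. Nothing here decides
(xi-f), takes a side on [IUTchIII] Cor. 3.12 or on any author (Mochizuki / Scholze–Stix), or asserts that abc is proved
or refuted; typed ≠ proved; indexed ≠ endorsed. [claim: Mochizuki2012, status: disputed]
-/

noncomputable section

namespace Summit.ABC.IUTFork.DAG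

open Cor312Proof Thm311 Literature.IUT.LogThetaLattice
open Cor312Vol Cor312Vol.GapWitness Cor312.IdentifiedNonVacuity

/-! ## §1 Step (xi-a) at the setting's own tautological strips datum — every situation, zero binders -/

section SigStrips

variable {T : ThetaIndex} (S : FullSituation T) (pending : Locus → Prop) (P : Cor312.Setting S.toSituation)

/-- **Step (xi-a), zero binders, every situation.** At the readings of record with the setting's own tautological strips
datum (`†𝔉^{⊩▶×μ}_LGP := FLGP` at every log-link, `*𝔉^{⊩▶×μ}_△ := Flgp` at every theater, [IUTchIII] Prop. 3.7 (iv)'s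
`isoLGPlgp` filling Def. 3.8 (ii)'s presupposition), the (xi-a) node holds — the SIDE binder `hNE` of part p's
`N_IUTchIII_Cor3_12_pf_xi_a_holds_of` is discharged by the signature (TEAM A's `hNE_satisfiable`, inlined). [folklore] -/
theorem N_IUTchIII_Cor3_12_pf_xi_a_holds_sigStrips :
    N_IUTchIII_Cor3_12_pf_xi_a (lociReadingI S pending)
      (obsReadingA S pending P ⟨fun _ => P.sig.FLGP, fun _ => P.sig.FLGP, fun _ => P.sig.Flgp⟩) :=
  N_IUTchIII_Cor3_12_pf_xi_a_holds_of S pending P _ fun _ _ => ⟨P.sig.isoLGPlgp⟩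

/-- Hence the (xi-a) node is SATISFIABLE at the readings of record over every full situation and setting (∃ a strips
datum), zero binders. [folklore] -/
theorem exists_strips_N_IUTchIII_Cor3_12_pf_xi_a :
    ∃ D : ThetaLinkStrips P.LogLink P.Strip, N_IUTchIII_Cor3_12_pf_xi_a (lociReadingI S pending) (obsReadingA S pending P D) :=
  ⟨_, N_IUTchIII_Cor3_12_pf_xi_a_holds_sigStrips S pending P⟩

end SigStrips

/-! ## §2 TEAM R's non-vacuity witness: (x), (xi-a), (xi-d) and the whole chain hold, zero binders -/

section NvWitness

variable (pending : Locus → Prop) (D : ThetaLinkStrips nvSetting.LogLink nvSetting.Strip)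

/-- **Log-volume invariance at TEAM R's witness.** The three-level log-volume `nvVol` (`−2` on subsets of `{0}`, `−1` on
other subsets of the ball, `0` elsewhere) of `nvData` is invariant under every (Ind1)- and every (Ind2)-family: these
act on each packet line by a sign (`actsBySigns_of_mem_Ind1Family` / `…Ind2Family`), so they fix `{0}` and the ball
(`image_ball_of_actsBySigns`). [folklore] -/
theorem nvData_logvolInvariant : nvData.LogvolInvariant := by
  intro Φ hΦ j vQ A _
  have hs : ActsBySigns Φ := hΦ.elim actsBySigns_of_mem_Ind1Family actsBySigns_of_mem_Ind2Family
  show nvVol j vQ (Φ j vQ '' A) = nvVol j vQ A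
  have h0 : (Φ j vQ '' A ⊆ ({0} : Set _)) ↔ A ⊆ ({0} : Set _) := by
    constructor
    · intro h x hx
      have hx0 : Φ j vQ x ∈ ({0} : Set _) := h ⟨x, hx, rfl⟩
      rw [Set.mem_singleton_iff] at hx0 ⊢
      exact (Φ j vQ).injective (by rw [hx0, map_zero])
    · rintro h _ ⟨x, hx, rfl⟩
      rw [Set.mem_singleton_iff, Set.mem_singleton_iff.mp (h hx), map_zero]
  have hb : (Φ j vQ '' A ⊆ ball j vQ) ↔ A ⊆ ball j vQ := by
    have e := image_ball_of_actsBySigns hs j vQ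
    constructor
    · intro h
      have h' : Φ j vQ '' A ⊆ Φ j vQ '' ball j vQ := by rwa [e]
      exact (Set.image_subset_image_iff (Φ j vQ).injective).1 h'
    · intro h
      have h' : Φ j vQ '' A ⊆ Φ j vQ '' ball j vQ := Set.image_mono h
      rwa [e] at h'
  unfold nvVol
  by_cases hA0 : A ⊆ ({0} : Set _)
  · rw [if_pos hA0, if_pos (h0.2 hA0)]
  · rw [if_neg hA0, if_neg (mt h0.1 hA0)]
    by_cases hAb : A ⊆ ball j vQ
    · rw [if_pos hAb, if_pos (hb.2 hAb)]
    · rw [if_neg hAb, if_neg (mt hb.1 hAb)]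

/-- **Step (x) at TEAM R's witness, zero binders**: the three coarse-volume SIDE binders of part p's
`N_IUTchIII_Cor3_12_pf_x_holds_of` hold there — everything is admissible (`Iff.rfl`), `nvData_logvolInvariant`,
`nvVol_mono`. [folklore] -/
theorem N_IUTchIII_Cor3_12_pf_x_holds_nvWitness :
    N_IUTchIII_Cor3_12_pf_x (lociReadingI nvFull pending) (obsReadingA nvFull pending nvSetting D) :=
  N_IUTchIII_Cor3_12_pf_x_holds_of nvFull pending nvSetting D (fun _ _ _ _ _ => Iff.rfl) nvData_logvolInvariant
    fun _ _ _ _ _ _ h => nvVol_mono h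

/-- **Step (xi-a) at TEAM R's witness, zero binders** (its strips are `Unit`-typed, so every strips datum fills `hNE`).
[folklore] -/
theorem N_IUTchIII_Cor3_12_pf_xi_a_holds_nvWitness :
    N_IUTchIII_Cor3_12_pf_xi_a (lociReadingI nvFull pending) (obsReadingA nvFull pending nvSetting D) :=
  N_IUTchIII_Cor3_12_pf_xi_a_holds_of nvFull pending nvSetting D fun _ _ => ⟨()⟩

/-- Step (xi-d) at TEAM R's witness, zero binders (`ThetaFinite` from its bridge hypotheses, `|log(q)| > 0` by
`nvSetting_absLogQPos`). [folklore] -/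
theorem N_IUTchIII_Cor3_12_pf_xi_d_holds_nvWitness :
    N_IUTchIII_Cor3_12_pf_xi_d (lociReadingI nvFull pending) (obsReadingA nvFull pending nvSetting D) :=
  N_IUTchIII_Cor3_12_pf_xi_d_holds_of nvFull pending nvSetting D nvSetting_bridgeHyps.finite nvSetting_absLogQPos

/-- Step (xi-f) at TEAM R's witness, zero binders (the typed Statement holds there; part r's
`N_IUTchIII_Cor3_12_pf_xi_f_holds_of_statement`, as in part t's `xi_f_hyps_satisfiable`). [folklore] -/
theorem N_IUTchIII_Cor3_12_pf_xi_f_holds_nvWitness :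
    N_IUTchIII_Cor3_12_pf_xi_f (lociReadingI nvFull pending) (obsReadingA nvFull pending nvSetting D) :=
  N_IUTchIII_Cor3_12_pf_xi_f_holds_of_statement nvFull pending nvSetting D nvSetting_statement

/-- **THE WHOLE TWENTY-NODE CHAIN OF THE PRINTED PROOF HOLDS AT TEAM R's WITNESS, ZERO BINDERS** — every `pending`, every
strips datum: part p's `chain_of_record` with all five side data and the one node (xi-f) discharged by the witness'
landed theorems. Interface level; says nothing about the intended model. [folklore] -/
theorem N_IUTchIII_Cor3_12_pf_holds_nvWitness :
    N_IUTchIII_Cor3_12_pf (lociReadingI nvFull pending) (obsReadingA nvFull pending nvSetting D) :=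
  chain_of_record nvFull pending nvSetting D (fun _ _ _ _ _ => Iff.rfl) nvData_logvolInvariant
    (fun _ _ _ _ _ _ h => nvVol_mono h) (fun _ _ => ⟨()⟩) nvSetting_bridgeHyps.finite nvSetting_absLogQPos
    (N_IUTchIII_Cor3_12_pf_xi_f_holds_nvWitness pending D)

/-- … so EVERY one of the twenty step nodes holds there, by name of the step. [folklore] -/
theorem stepNode_holds_nvWitness (s : Step) :
    s.Holds (locusNode (lociReadingI nvFull pending)) (obsReadingA nvFull pending nvSetting D) :=
  N_IUTchIII_Cor3_12_pf_holds_nvWitness pending D s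

end NvWitness

/-! ## §3 TEAM A's gap witness: (x), (xi-a), (xi-d) and every node but (xi-f) hold; the chain fails — zero binders -/

section GapWitness

variable (pending : Locus → Prop) (D : ThetaLinkStrips gapSetting.LogLink gapSetting.Strip)

/-- **Step (x) at TEAM A's gap witness, zero binders**: everything admissible (`Iff.rfl`), `gapData_logvolInvariant`
(Cor312TeamAHonestCensus), `gapData_logvol_mono`. [folklore] -/
theorem N_IUTchIII_Cor3_12_pf_x_holds_gapWitness :
    N_IUTchIII_Cor3_12_pf_x (lociReadingI gapFull pending) (obsReadingA gapFull pending gapSetting D) :=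
  N_IUTchIII_Cor3_12_pf_x_holds_of gapFull pending gapSetting D (fun _ _ _ _ _ => Iff.rfl) gapData_logvolInvariant
    fun _ _ _ _ _ _ h => gapData_logvol_mono h

/-- **Step (xi-a) at TEAM A's gap witness, zero binders** (`Unit`-typed strips). [folklore] -/
theorem N_IUTchIII_Cor3_12_pf_xi_a_holds_gapWitness :
    N_IUTchIII_Cor3_12_pf_xi_a (lociReadingI gapFull pending) (obsReadingA gapFull pending gapSetting D) :=
  N_IUTchIII_Cor3_12_pf_xi_a_holds_of gapFull pending gapSetting D fun _ _ => ⟨()⟩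

/-- Step (xi-d) at TEAM A's gap witness, zero binders (`gap_thetaFinite`, `gapSetting_absLogQPos`). [folklore] -/
theorem N_IUTchIII_Cor3_12_pf_xi_d_holds_gapWitness :
    N_IUTchIII_Cor3_12_pf_xi_d (lociReadingI gapFull pending) (obsReadingA gapFull pending gapSetting D) :=
  N_IUTchIII_Cor3_12_pf_xi_d_holds_of gapFull pending gapSetting D gap_thetaFinite gapSetting_absLogQPos

/-- Step (xi-f) FAILS at TEAM A's gap witness (part t's `xi_f_not_automatic`, by name at the witness): the typed Statement
fails there (`gapSetting_not_statement`) and the node is equivalent to it (part p). [folklore] -/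
theorem not_N_IUTchIII_Cor3_12_pf_xi_f_gapWitness :
    ¬ N_IUTchIII_Cor3_12_pf_xi_f (lociReadingI gapFull pending) (obsReadingA gapFull pending gapSetting D) := fun h =>
  gapSetting_not_statement
    ((N_IUTchIII_Cor3_12_pf_xi_f_iff_statement gapFull pending gapSetting D gap_thetaFinite gapSetting_absLogQPos).1 h)

/-- **EVERY NODE OTHER THAN (xi-f) HOLDS AT THE GAP WITNESS, zero binders** — sixteen outright (part p), (x), (xi-a), (xi-d)
by the three instances above. [folklore] -/
theorem stepNode_holds_gapWitness_of_ne_xi_f (s : Step) (hs : s ≠ .xi_f) :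
    s.Holds (locusNode (lociReadingI gapFull pending)) (obsReadingA gapFull pending gapSetting D) := by
  cases s
  case wlog => exact N_IUTchIII_Cor3_12_pf_WLOG_holds gapFull pending gapSetting D
  case i => exact N_IUTchIII_Cor3_12_pf_i_holds gapFull pending gapSetting D
  case ii => exact N_IUTchIII_Cor3_12_pf_ii_holds gapFull pending gapSetting D
  case iii => exact N_IUTchIII_Cor3_12_pf_iii_holds gapFull pending gapSetting D
  case iv => exact N_IUTchIII_Cor3_12_pf_iv_holds gapFull pending gapSetting D
  case v => exact N_IUTchIII_Cor3_12_pf_v_holds gapFull pending gapSetting D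
  case vi => exact N_IUTchIII_Cor3_12_pf_vi_holds gapFull pending gapSetting D
  case vii => exact N_IUTchIII_Cor3_12_pf_vii_holds gapFull pending gapSetting D
  case viii => exact N_IUTchIII_Cor3_12_pf_viii_holds gapFull pending gapSetting D
  case ix => exact N_IUTchIII_Cor3_12_pf_ix_holds gapFull pending gapSetting D
  case x => exact N_IUTchIII_Cor3_12_pf_x_holds_gapWitness pending D
  case xi_a => exact N_IUTchIII_Cor3_12_pf_xi_a_holds_gapWitness pending D
  case xi_b => exact N_IUTchIII_Cor3_12_pf_xi_b_holds gapFull pending gapSetting D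
  case xi_c => exact N_IUTchIII_Cor3_12_pf_xi_c_holds gapFull pending gapSetting D
  case xi_d => exact N_IUTchIII_Cor3_12_pf_xi_d_holds_gapWitness pending D
  case xi_e => exact N_IUTchIII_Cor3_12_pf_xi_e_holds gapFull pending gapSetting D
  case xi_f => exact absurd rfl hs
  case xi_g => exact N_IUTchIII_Cor3_12_pf_xi_g_holds gapFull pending gapSetting D
  case xi_h => exact N_IUTchIII_Cor3_12_pf_xi_h_holds gapFull pending gapSetting D
  case xii => exact N_IUTchIII_Cor3_12_pf_xii_holds gapFull pending gapSetting D

/-- **THE WHOLE TWENTY-NODE CHAIN FAILS AT THE GAP WITNESS, zero binders** — and it fails AT (xi-f) ONLY (previous theorem).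
[folklore] -/
theorem not_N_IUTchIII_Cor3_12_pf_gapWitness :
    ¬ N_IUTchIII_Cor3_12_pf (lociReadingI gapFull pending) (obsReadingA gapFull pending gapSetting D) := fun h =>
  not_N_IUTchIII_Cor3_12_pf_xi_f_gapWitness pending D (h .xi_f)

/-- At the gap witness the chain is EQUIVALENT to its one node (xi-f) (both fail; the other nineteen hold). [folklore] -/
theorem N_IUTchIII_Cor3_12_pf_iff_xi_f_gapWitness :
    N_IUTchIII_Cor3_12_pf (lociReadingI gapFull pending) (obsReadingA gapFull pending gapSetting D) ↔
      N_IUTchIII_Cor3_12_pf_xi_f (lociReadingI gapFull pending) (obsReadingA gapFull pending gapSetting D) :=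
  ⟨fun h => h .xi_f, fun h s => if hs : s = .xi_f then hs ▸ h else stepNode_holds_gapWitness_of_ne_xi_f pending D s hs⟩

end GapWitness

/-! ## §4 The chain under the readings of record is decided NEITHER way by Theorem 3.11 as typed -/

/-- **SATISFIABLE AND NOT AUTOMATIC.** Over full situations in which Theorem 3.11 AS TYPED holds (with `ThetaFinite` and
`|log(q)| > 0`), the twenty-node chain of the printed proof of Cor. 3.12 under the readings of record HOLDS somewhere
(TEAM R's non-vacuity witness) and FAILS somewhere (TEAM A's gap witness), for every loci parameter — the chain-level
form of part t's `xi_f_node_undecided_by_typed_thm311`. Interface level; no side taken. [folklore] -/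
theorem N_IUTchIII_Cor3_12_pf_undecided_by_typed_thm311 :
    (∃ (T : ThetaIndex) (S : FullSituation T) (P : Cor312.Setting S.toSituation) (D : ThetaLinkStrips P.LogLink P.Strip),
      S.Statement ∧ P.ThetaFinite ∧ P.AbsLogQPos ∧
        ∀ pending : Locus → Prop, N_IUTchIII_Cor3_12_pf (lociReadingI S pending) (obsReadingA S pending P D)) ∧
    (∃ (T : ThetaIndex) (S : FullSituation T) (P : Cor312.Setting S.toSituation) (D : ThetaLinkStrips P.LogLink P.Strip),
      S.Statement ∧ P.ThetaFinite ∧ P.AbsLogQPos ∧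
        ∀ pending : Locus → Prop, ¬ N_IUTchIII_Cor3_12_pf (lociReadingI S pending) (obsReadingA S pending P D)) :=
  ⟨⟨Cor312.Checks.toyIndex, nvFull, nvSetting, ⟨fun _ => (), fun _ => (), fun _ => ()⟩, nvFull_statement,
      nvSetting_bridgeHyps.finite, nvSetting_absLogQPos, fun pending => N_IUTchIII_Cor3_12_pf_holds_nvWitness pending _⟩,
    ⟨Cor312.Checks.toyIndex, gapFull, gapSetting, ⟨fun _ => (), fun _ => (), fun _ => ()⟩, gapFull_statement,
      gap_thetaFinite, gapSetting_absLogQPos, fun pending => not_N_IUTchIII_Cor3_12_pf_gapWitness pending _⟩⟩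

/-- Hence the universal closure of the CHAIN node over full situations satisfying typed Thm 3.11 (readings of record) is
refuted NON-VACUOUSLY — not at a junk reading but at a full situation where Theorem 3.11 as typed holds. [folklore] -/
theorem not_forall_N_IUTchIII_Cor3_12_pf_of_typed_thm311 :
    ¬ ∀ (T : ThetaIndex) (S : FullSituation T) (P : Cor312.Setting S.toSituation) (D : ThetaLinkStrips P.LogLink P.Strip)
        (pending : Locus → Prop), S.Statement → P.ThetaFinite → P.AbsLogQPos →
        N_IUTchIII_Cor3_12_pf (lociReadingI S pending) (obsReadingA S pending P D) := by
  intro h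
  obtain ⟨T, S, P, D, hS, hfin, hq, hnot⟩ := N_IUTchIII_Cor3_12_pf_undecided_by_typed_thm311.2
  exact hnot (fun _ => True) (h T S P D _ hS hfin hq)


end Summit.ABC.IUTFork.DAG

end
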